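import Literature.Geometry.Lorentzian.FinalEraPackage2
import HarnessLib

/-!
# Crux `DispersingCapture` (stmt-FinalStateConjecture-17643), line `registered` (birth r4) —
# stub `stub_separation` (B_sep: the rest-frame hole tubes of every radius separate)

For a rev-2 final era `IsFinalEra₂ N M a T δ V C₁ C₂ ρ₀ κ ξ β U₀ B₀ B Ψ₀ Ψ O` of a vacuum Cauchy
development whose labels pairwise disperse (`‖ξᵢ(t) − ξⱼ(t)‖ → ∞` for `i ≠ j`), for every radius
`R'` there is a hole time `τ'` after which the truncated tubes `Ψᵢ({t*ᵢ > τ', rᵢ ≤ R'})` of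
distinct labels are pairwise disjoint. Pure bookkeeping over the package clauses (B), (P), (X1),
(X2), (X4) of `CauchyDevelopment.IsFinalEra₂`:

* by dispersal (finitely many pairs) there is `t⋆` with `2 (C₂ R' + C₁) < ‖ξᵢ(t) − ξⱼ(t)‖` for all
  `t ≥ t⋆` and all `i ≠ j`;
* by (X4) (`clock_hole`) at `t₀ = t⋆` there are hole times `τc i` such that `Ψᵢ({t*ᵢ > τc i})`
  avoids `Ψ₀({y⁰ ≤ t⋆})`; put `τ' := max T (Σᵢ |τc i|)`;
* a common point `p = Ψᵢ x = Ψⱼ x'` of two truncated tubes after `τ'` lies in `range Ψ₀` by (X1)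
  (`τ' ≥ T`), `p = Ψ₀ y`, and `y⁰ > t⋆` by the choice of `τc i ≤ τ'`; by (X2) twice
  `‖y̲ − ξᵢ(y⁰)‖, ‖y̲ − ξⱼ(y⁰)‖ ≤ C₂ R' + C₁` (`C₂ ≥ 1`, `rᵢ(x), rⱼ(x') ≤ R'`), so
  `‖ξᵢ(y⁰) − ξⱼ(y⁰)‖ ≤ 2 (C₂ R' + C₁)`, contradicting dispersal at `t = y⁰ ≥ t⋆`.

The hole backgrounds are `Kerr.background (Mᵢ, aᵢ)` (clause (B), substituted), whose time function
is the coordinate `x⁰`, so "hole time `> τ'`" is `x⁰ > τ'` as (X2) requires.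

References: Dafermos–Luk arXiv:1710.01722, Conjecture 1 (holes moving apart); DHRT
arXiv:2104.08222, §1 (late-time charts and near zones).
-/

set_option linter.dupNamespace false

noncomputable section

open scoped Manifold ContDiff Topology
open Filter Set Function Literature.Geometry.Lorentzian

namespace Summit.FinalStateConjecture.FinalStateConjecture.Theorems.DissipativeFinalMotions.DispersingCapture

/-- **B_sep — SEPARATION OF THE REST-FRAME HOLE TUBES AT EVERY RADIUS.** For a rev-2 final era
whose labels pairwise disperse, for every radius `R'` there is a hole time `τ'` after which the
truncated tubes `Ψᵢ({t*ᵢ > τ', rᵢ ≤ R'})` of distinct labels are pairwise disjoint. Proof: a common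
point `p = Ψᵢ x = Ψⱼ x'` of two late tubes lies in `range Ψ₀` by (X1), `p = Ψ₀ y`; by (X2) (chart
localisation, `x⁰, x'⁰ > T`) `‖y̲ − ξᵢ(y⁰)‖, ‖y̲ − ξⱼ(y⁰)‖ ≤ C₂ R' + C₁`, so
`‖ξᵢ(y⁰) − ξⱼ(y⁰)‖ ≤ 2(C₂R' + C₁)`; by dispersal this fails for `y⁰ ≥ t⋆` (finitely many pairs); by
(X4) `clock_hole` at `t₀ = t⋆` hole times `> τc i` force flat time `> t⋆`; take
`τ' = max T (Σᵢ |τc i|)`. Sources: Dafermos–Luk arXiv:1710.01722 (Conj. 1, holes moving apart),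
arXiv:2104.08222 §1. -/
theorem stub_separation : open scoped Manifold Topology in ∀ (X : Type) [TopologicalSpace X] [ChartedSpace (EuclideanSpace ℝ (Fin 3)) X] [IsManifold (𝓡 3) ((⊤ : ℕ∞) : WithTop ℕ∞) X] [T2Space X] [SecondCountableTopology X] [ConnectedSpace X], ∀ (D : Literature.Geometry.Lorentzian.InitialDataSet (𝓡 3) X) (𝒟 : Literature.Geometry.Lorentzian.VacuumCauchyDevelopment D) (N : ℕ) (M a : Fin N → ℝ) (T δ V C₁ C₂ ρ₀ κ : ℝ) (ξ : Fin N → ℝ → EuclideanSpace ℝ (Fin 3)) (β : ℝ → ℝ) (U₀ : TopologicalSpace.Opens Literature.Geometry.Lorentzian.E4) (B₀ : Literature.Geometry.Lorentzian.ModelBackground) (B : Fin N → Literature.Geometry.Lorentzian.ModelBackground) (Ψ₀ : B₀.domain → 𝒟.carrier) (Ψ : (i : Fin N) → (B i).domain → 𝒟.carrier) (O : Set 𝒟.carrier), 𝒟.toCauchyDevelopment.IsFinalEra₂ N M a T δ V C₁ C₂ ρ₀ κ ξ β U₀ B₀ B Ψ₀ Ψ O → (∀ i j, i ≠ j → Filter.Tendsto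 (fun t ↦ ‖ξ i t - ξ j t‖) Filter.atTop Filter.atTop) →
    ∀ R' : ℝ, ∃ τ' : ℝ, Pairwise (Function.onFun Disjoint fun i ↦ Ψ i '' (B i).truncLateRegion τ' R') := by
  intro X _ _ _ _ _ _ D 𝒟 N M a T _δ _V C₁ C₂ _ρ₀ _κ ξ _β _U₀ B₀ B Ψ₀ Ψ _O hera hdisp R'
  obtain ⟨-, -, hB, -, -, -, -, hC₁, hC₂, -, -, -, -, -, -, -, -, -, -, -, -, -, -, hX1, hX2, -,
    hX4, -, -, -, -⟩ := hera
  subst hB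
  -- dispersal, uniformly over the finitely many pairs: `2 (C₂ R' + C₁) < ‖ξᵢ(t) − ξⱼ(t)‖` for
  -- `t ≥ t⋆` and `i ≠ j`
  have hev : ∀ᶠ t in atTop, ∀ i j, i ≠ j → 2 * (C₂ * R' + C₁) < ‖ξ i t - ξ j t‖ := by
    refine eventually_all.2 fun i ↦ eventually_all.2 fun j ↦ ?_
    by_cases hij : i = j
    · exact Eventually.of_forall fun _ h ↦ absurd hij h
    · exact ((hdisp i j hij).eventually_gt_atTop _).mono fun _ ht _ ↦ ht
  obtain ⟨tstar, htstar⟩ := eventually_atTop.1 hev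
  -- clock comparison (X4) at `t₀ = t⋆`, one hole time per label, and a common bound
  choose τc hτc using fun i ↦ hX4 i tstar
  have hτc_le : ∀ i, τc i ≤ ∑ j, |τc j| := fun i ↦
    (le_abs_self _).trans (Finset.single_le_sum (fun j _ ↦ abs_nonneg (τc j)) (Finset.mem_univ i))
  refine ⟨max T (∑ j, |τc j|), ?_⟩
  intro i j hij
  rw [Function.onFun_apply, Set.disjoint_left]
  rintro _ ⟨x, hx, rfl⟩ ⟨x', hx', hpp⟩
  -- hole times `> τ' ≥ T`, radii `≤ R'`
  have hxT : T < x.1 0 := (le_max_left _ _).trans_lt hx.1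
  have hx'T : T < x'.1 0 := (le_max_left _ _).trans_lt hx'.1
  have hxc : τc i < x.1 0 := ((hτc_le i).trans (le_max_right T _)).trans_lt hx.1
  -- (X1): the common point is flat-charted, `Ψ i x = Ψ₀ y`
  obtain ⟨y, hy⟩ := hX1 i j hij ⟨⟨x, hxT, rfl⟩, x', hx'T, hpp⟩
  -- (X4): its flat time exceeds `t⋆`
  have hy0 : tstar < y.1 0 := by
    refine lt_of_not_ge fun hle ↦ ?_
    exact (Set.eq_empty_iff_forall_notMem.1 (hτc i)) (Ψ i x) ⟨⟨x, hxc, rfl⟩, y, hle, hy⟩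
  -- (X2) twice, and the triangle inequality
  have h₁ := hX2 i x y hxT hy.symm
  have h₂ := hX2 j x' y hx'T (hpp.trans hy.symm)
  have hC₂0 : 0 ≤ C₂ := zero_le_one.trans hC₂
  have h₁r := mul_le_mul_of_nonneg_left hx.2 hC₂0
  have h₂r := mul_le_mul_of_nonneg_left hx'.2 hC₂0
  have htri : ‖ξ i (y.1 0) - ξ j (y.1 0)‖ ≤
      ‖E4.spatial y.1 - ξ j (y.1 0)‖ + ‖E4.spatial y.1 - ξ i (y.1 0)‖ := by
    rw [← sub_sub_sub_cancel_left (ξ j (y.1 0)) (ξ i (y.1 0)) (E4.spatial y.1)]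
    exact norm_sub_le _ _
  have hfar := htstar (y.1 0) hy0.le i j hij
  linarith

end Summit.FinalStateConjecture.FinalStateConjecture.Theorems.DissipativeFinalMotions.DispersingCapture

end
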